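import Summits.CriticalPhenomena.PercolationContinuityZ3.Theorems.PercNearOneGluingNoHeavyLowerTailNetworkFoldGlue
import HarnessLib

/-!
# `NoHeavyLowerTail` (stmt-CriticalPhenomena-4575) — HUB PAIRS WITH THE APEX ALONE ON ITS SIDE, part 1 (combinatorics):
# an apex arm glued at `{h₁, h₂}` is seen by the rest only through the partition of `{a, h₁, h₂}` it induces

Support file (prover prim-gen-kcluster gen 72; `--supports stmt-CriticalPhenomena-4575`).  Pure graph combinatorics: no measures, no definitions,
no named facts, no sorries.  SETTING (KCLUSTER-gen65 §0.1 "Θ-identity", here with an ARBITRARY far side): an APEX ARM is a pair set `ζ_A` (inside a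
support `DA`) containing the apex `a` and meeting the rest `ζ_Y ⊆ DY` only in the hubs `h₁, h₂`; `a` lies on no pair of `DY`; the vertices looked at
(`b, c`, the hubs) lie on pairs of `DA` only as `a, h₁, h₂`.
* `HubPairApex.mem_cl_arm_imp`, `mem_cl_arm_replace` — two apex arms inducing the same partition of `{a, h₁, h₂}` give the same clusters of the
  non-inner vertices (projection of the inner vertices of the arm onto `a, h₁, h₂`; pairs go to reachable pairs, `NetworkFold.reachable_map_of_adj`);
* `HubPairApex.sep_arm_replace` — and the same support separation `Sep (DA ∪ DY) (C(a)) b c`, provided `c ∈ cl DY b` (no hub in `C(a)` ⇒ `C(a)` misses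
  the rest; a hub in `C(a)` ⇒ off `C(a)` the arm is a network not joining its poles, `NetworkFold.mem_cl_replace`);
* event forms against the REFERENCE ARM `DA' = {ah₁, ah₂, h₁h₂}`: for a reference block `g ⊆ DA'` inducing the same partition as `ω ∩ DA`,
  `y ∈ C(x)` in `ω` iff in `g ∪ (ω ∖ DA)` (`mem_cl_iff_ref`), and the separation rule (`sep_iff_ref`).
Part 2 (`…HubPairApex`) is the measure-level Θ-identity: the R1 slack of the glued graph is a quadratic form in the three relevant wired apex-arm
masses whose six coefficients are R1 / CROSS / free–wired cross forms of the far side.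
-/

namespace Summit.CriticalPhenomena.PercolationContinuityZ3.Theorems

namespace HubPairApex

open SimpleGraph Finset Literature.Probability.Percolation Literature.Probability.Percolation.Gladkov
open Literature.Probability.LatticeModels RefinedRowR3 ThreePointLB APL
open scoped Classical

variable {V : Type*} [Fintype V]

/-! ### Replacing an apex arm -/

section Replace

variable {ζA ζA' ζY : Finset (Sym2 V)} {a h₁ h₂ x y : V}

/-- Two special vertices joined in the arm are joined in any arm with the same partition (one direction suffices). [this work] -/
theorem special_pair (hP1 : h₁ ∈ cl ζA a → h₁ ∈ cl ζA' a) (hP2 : h₂ ∈ cl ζA a → h₂ ∈ cl ζA' a)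
    (hP12 : h₂ ∈ cl ζA h₁ → h₂ ∈ cl ζA' h₁) {p p' : V} (hp : p = a ∨ p = h₁ ∨ p = h₂) (hp' : p' = a ∨ p' = h₁ ∨ p' = h₂)
    (h : p' ∈ cl ζA p) : p' ∈ cl ζA' p := by
  rcases hp with rfl | rfl | rfl <;> rcases hp' with rfl | rfl | rfl
  · exact mem_cl_self _ _
  · exact hP1 h
  · exact hP2 h
  · exact mem_cl_comm.1 (hP1 (mem_cl_comm.1 h))
  · exact mem_cl_self _ _
  · exact hP12 h
  · exact mem_cl_comm.1 (hP2 (mem_cl_comm.1 h))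
  · exact mem_cl_comm.1 (hP12 (mem_cl_comm.1 h))
  · exact mem_cl_self _ _

/-- **An apex arm is seen only through the partition of `{a, h₁, h₂}`** (one direction): if the arm `ζ_A` meets `ζ_Y` only in the hubs, `x, y` lie on
arm pairs only as `a, h₁, h₂`, and every two of `a, h₁, h₂` joined in `ζ_A` are joined in `ζ_A'`, then `y ∈ cl (ζ_A ∪ ζ_Y) x → y ∈ cl (ζ_A' ∪ ζ_Y) x`.
(Project an inner arm vertex to `a`, `h₁`, `h₂` — the first one in its arm cluster — or to `a` if there is none.) [this work] -/
theorem mem_cl_arm_imp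
    (hsep : ∀ z : V, (∃ e ∈ ζA, z ∈ e) → (∃ e ∈ ζY, z ∈ e) → (z = h₁ ∨ z = h₂))
    (hx : ∀ e ∈ ζA, x ∈ e → (x = a ∨ x = h₁ ∨ x = h₂)) (hy : ∀ e ∈ ζA, y ∈ e → (y = a ∨ y = h₁ ∨ y = h₂))
    (hP1 : h₁ ∈ cl ζA a → h₁ ∈ cl ζA' a) (hP2 : h₂ ∈ cl ζA a → h₂ ∈ cl ζA' a) (hP12 : h₂ ∈ cl ζA h₁ → h₂ ∈ cl ζA' h₁)
    (h : y ∈ cl (ζA ∪ ζY) x) : y ∈ cl (ζA' ∪ ζY) x := by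
  rw [mem_cl] at h ⊢
  -- the projection
  set ρ : V → V := fun z =>
    if (∃ e ∈ ζA, z ∈ e) ∧ ¬ (z = a ∨ z = h₁ ∨ z = h₂) then
      (if z ∈ cl ζA a then a else if z ∈ cl ζA h₁ then h₁ else if z ∈ cl ζA h₂ then h₂ else a)
    else z with hρ
  have hfix : ∀ z, (∀ e ∈ ζA, z ∈ e → (z = a ∨ z = h₁ ∨ z = h₂)) → ρ z = z := by
    intro z hz
    simp only [hρ]
    rw [if_neg]
    exact fun ⟨⟨e, he, hze⟩, hns⟩ => hns (hz e he hze)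
  have key := NetworkFold.reachable_map_of_adj (G := openGraph (↑(ζA ∪ ζY) : Set (Sym2 V)))
    (H := openGraph (↑(ζA' ∪ ζY) : Set (Sym2 V))) ρ ?_ h
  · rwa [hfix x hx, hfix y hy] at key
  intro z z' hzz'
  rw [openGraph_adj, Finset.mem_coe, Finset.mem_union] at hzz'
  obtain ⟨hAY, hne⟩ := hzz'
  rcases hAY with hA | hY
  · -- an arm pair
    have hadj : (openGraph (↑ζA : Set (Sym2 V))).Adj z z' := by
      rw [openGraph_adj, Finset.mem_coe]; exact ⟨hA, hne⟩
    have hzz'A : z' ∈ cl ζA z := mem_cl_of_adj (mem_cl_self _ _) hadj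
    by_cases hK : a ∈ cl ζA z ∨ h₁ ∈ cl ζA z ∨ h₂ ∈ cl ζA z
    · -- the arm cluster of the pair contains a special vertex: both images are special vertices of that cluster
      have himg : ∀ t, t ∈ s(z, z') → ((ρ t = a ∨ ρ t = h₁ ∨ ρ t = h₂) ∧ ρ t ∈ cl ζA t) := by
        intro t ht
        have htz : t ∈ cl ζA z := by
          rcases Sym2.mem_iff.1 ht with rfl | rfl
          · exact mem_cl_self _ _
          · exact hzz'A
        by_cases hts : t = a ∨ t = h₁ ∨ t = h₂
        · rw [hfix t (fun _ _ _ => hts)]; exact ⟨hts, mem_cl_self _ _⟩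
        · have hcond : (∃ e ∈ ζA, t ∈ e) ∧ ¬ (t = a ∨ t = h₁ ∨ t = h₂) := ⟨⟨_, hA, ht⟩, hts⟩
          simp only [hρ]
          rw [if_pos hcond]
          by_cases h1 : t ∈ cl ζA a
          · rw [if_pos h1]; exact ⟨Or.inl rfl, mem_cl_comm.1 h1⟩
          rw [if_neg h1]
          by_cases h2 : t ∈ cl ζA h₁
          · rw [if_pos h2]; exact ⟨Or.inr (Or.inl rfl), mem_cl_comm.1 h2⟩
          rw [if_neg h2]
          by_cases h3 : t ∈ cl ζA h₂
          · rw [if_pos h3]; exact ⟨Or.inr (Or.inr rfl), mem_cl_comm.1 h3⟩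
          · exfalso
            rcases hK with h' | h' | h'
            · exact h1 (mem_cl_trans (mem_cl_comm.1 h') htz)
            · exact h2 (mem_cl_trans (mem_cl_comm.1 h') htz)
            · exact h3 (mem_cl_trans (mem_cl_comm.1 h') htz)
      obtain ⟨hsz, hcz⟩ := himg z (Sym2.mem_mk_left z z')
      obtain ⟨hsz', hcz'⟩ := himg z' (Sym2.mem_mk_right z z')
      have hzz : ρ z' ∈ cl ζA (ρ z) := mem_cl_trans (mem_cl_trans (mem_cl_comm.1 hcz) hzz'A) hcz'
      exact mem_cl.1 (cl_mono Finset.subset_union_left (ρ z) (special_pair hP1 hP2 hP12 hsz hsz' hzz))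
    · -- no special vertex in the arm cluster of the pair: both endpoints are inner and go to `a`
      have hinner : ∀ t, t ∈ s(z, z') → ρ t = a := by
        intro t ht
        have htz : t ∈ cl ζA z := by
          rcases Sym2.mem_iff.1 ht with rfl | rfl
          · exact mem_cl_self _ _
          · exact hzz'A
        have hts : ¬ (t = a ∨ t = h₁ ∨ t = h₂) := by
          rintro (rfl | rfl | rfl)
          · exact hK (Or.inl htz)
          · exact hK (Or.inr (Or.inl htz))
          · exact hK (Or.inr (Or.inr htz))
        have h1 : t ∉ cl ζA a := fun h => hK (Or.inl (mem_cl_trans htz (mem_cl_comm.1 h)))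
        have h2 : t ∉ cl ζA h₁ := fun h => hK (Or.inr (Or.inl (mem_cl_trans htz (mem_cl_comm.1 h))))
        have h3 : t ∉ cl ζA h₂ := fun h => hK (Or.inr (Or.inr (mem_cl_trans htz (mem_cl_comm.1 h))))
        simp only [hρ]
        rw [if_pos ⟨⟨_, hA, ht⟩, hts⟩, if_neg h1, if_neg h2, if_neg h3]
      rw [hinner z (Sym2.mem_mk_left z z'), hinner z' (Sym2.mem_mk_right z z')]
  · -- a pair of the rest: both endpoints fixed
    have hfixY : ∀ t, t ∈ s(z, z') → ρ t = t := fun t ht =>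
      hfix t (fun e he hte => Or.inr (hsep t ⟨e, he, hte⟩ ⟨_, hY, ht⟩))
    rw [hfixY z (Sym2.mem_mk_left z z'), hfixY z' (Sym2.mem_mk_right z z')]
    refine Adj.reachable ?_
    rw [openGraph_adj, Finset.mem_coe, Finset.mem_union]; exact ⟨Or.inr hY, hne⟩

/-- **Two apex arms inducing the same partition of `{a, h₁, h₂}` give the same clusters of non-inner vertices.** [this work] -/
theorem mem_cl_arm_replace
    (hsep : ∀ z : V, (∃ e ∈ ζA, z ∈ e) → (∃ e ∈ ζY, z ∈ e) → (z = h₁ ∨ z = h₂))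
    (hsep' : ∀ z : V, (∃ e ∈ ζA', z ∈ e) → (∃ e ∈ ζY, z ∈ e) → (z = h₁ ∨ z = h₂))
    (hx : ∀ e ∈ ζA, x ∈ e → (x = a ∨ x = h₁ ∨ x = h₂)) (hx' : ∀ e ∈ ζA', x ∈ e → (x = a ∨ x = h₁ ∨ x = h₂))
    (hy : ∀ e ∈ ζA, y ∈ e → (y = a ∨ y = h₁ ∨ y = h₂)) (hy' : ∀ e ∈ ζA', y ∈ e → (y = a ∨ y = h₁ ∨ y = h₂))
    (hP1 : h₁ ∈ cl ζA a ↔ h₁ ∈ cl ζA' a) (hP2 : h₂ ∈ cl ζA a ↔ h₂ ∈ cl ζA' a) (hP12 : h₂ ∈ cl ζA h₁ ↔ h₂ ∈ cl ζA' h₁) :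
    y ∈ cl (ζA ∪ ζY) x ↔ y ∈ cl (ζA' ∪ ζY) x :=
  ⟨mem_cl_arm_imp hsep hx hy hP1.1 hP2.1 hP12.1, mem_cl_arm_imp hsep' hx' hy' hP1.2 hP2.2 hP12.2⟩

end Replace

/-! ### Support separation -/

section Separation

variable {DA DA' DY ζA ζA' ζY : Finset (Sym2 V)} {a h₁ h₂ b c : V}

/-- If no hub is in `C(a)` then no pair of the rest touches `C(a)`. [this work] -/
theorem touch_rest_eq_of_no_hub
    (hsepD : ∀ z : V, (∃ e ∈ DA, z ∈ e) → (∃ e ∈ DY, z ∈ e) → (z = h₁ ∨ z = h₂))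
    (hζA : ζA ⊆ DA) (hζY : ζY ⊆ DY) (haY : ∀ e ∈ DY, a ∉ e)
    (h1 : h₁ ∉ cl (ζA ∪ ζY) a) (h2 : h₂ ∉ cl (ζA ∪ ζY) a) : DY \ touch (cl (ζA ∪ ζY) a) = DY := by
  refine Finset.sdiff_eq_self_of_disjoint (Finset.disjoint_left.2 fun e he heT => ?_)
  obtain ⟨z, hzW, hze⟩ := mem_touch.1 heT
  have hza : z ≠ a := fun h => haY e he (h ▸ hze)
  -- `z` lies on a pair of `ζA ∪ ζY`; the rest is a network with poles `h₁, h₂` for the apex `a`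
  have hzY : ∀ f ∈ ζY, z ∈ f → (z = h₁ ∨ z = h₂) := by
    have key := NetworkFold.not_inner_of_mem_cl (ζX := ζY) (ζY := ζA) (u := h₁) (v := h₂) (a := a)
      (fun t ht1 ht2 => hsepD t (ht2.imp fun f hf => ⟨hζA hf.1, hf.2⟩) (ht1.imp fun f hf => ⟨hζY hf.1, hf.2⟩))
      (fun f hf haf => absurd haf (haY f (hζY hf)))
    rw [Finset.union_comm] at key
    exact key h1 h2 hzW
  obtain ⟨f, hf, hzf⟩ := exists_mem_edge_of_mem_cl hzW hza
  have hz : z = h₁ ∨ z = h₂ := (Finset.mem_union.1 hf).elim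
    (fun hfA => hsepD z ⟨f, hζA hfA, hzf⟩ ⟨e, he, hze⟩) (fun hfY => hzY f hfY hzf)
  exact hz.elim (fun h => h1 (h ▸ hzW)) (fun h => h2 (h ▸ hzW))

/-- **Replacing an apex arm by another with the same partition preserves support separation** (given `c ∈ cl DY b`). [this work] -/
theorem sep_arm_replace (h12 : h₁ ≠ h₂)
    (hsepD : ∀ z : V, (∃ e ∈ DA, z ∈ e) → (∃ e ∈ DY, z ∈ e) → (z = h₁ ∨ z = h₂))
    (hsepD' : ∀ z : V, (∃ e ∈ DA', z ∈ e) → (∃ e ∈ DY, z ∈ e) → (z = h₁ ∨ z = h₂))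
    (hζA : ζA ⊆ DA) (hζA' : ζA' ⊆ DA') (hζY : ζY ⊆ DY) (haY : ∀ e ∈ DY, a ∉ e)
    (hb : ∀ e ∈ DA, b ∈ e → (b = h₁ ∨ b = h₂)) (hb' : ∀ e ∈ DA', b ∈ e → (b = h₁ ∨ b = h₂))
    (hc : ∀ e ∈ DA, c ∈ e → (c = h₁ ∨ c = h₂)) (hc' : ∀ e ∈ DA', c ∈ e → (c = h₁ ∨ c = h₂))
    (hbc : c ∈ cl DY b)
    (hP1 : h₁ ∈ cl ζA a ↔ h₁ ∈ cl ζA' a) (hP2 : h₂ ∈ cl ζA a ↔ h₂ ∈ cl ζA' a) (hP12 : h₂ ∈ cl ζA h₁ ↔ h₂ ∈ cl ζA' h₁) :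
    Sep (DA ∪ DY) (cl (ζA ∪ ζY) a) b c ↔ Sep (DA' ∪ DY) (cl (ζA' ∪ ζY) a) b c := by
  set W := cl (ζA ∪ ζY) a with hW
  set W' := cl (ζA' ∪ ζY) a with hW'
  have hsep : ∀ z : V, (∃ e ∈ ζA, z ∈ e) → (∃ e ∈ ζY, z ∈ e) → (z = h₁ ∨ z = h₂) :=
    fun z ⟨e, he, hze⟩ ⟨e', he', hze'⟩ => hsepD z ⟨e, hζA he, hze⟩ ⟨e', hζY he', hze'⟩
  have hsep' : ∀ z : V, (∃ e ∈ ζA', z ∈ e) → (∃ e ∈ ζY, z ∈ e) → (z = h₁ ∨ z = h₂) :=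
    fun z ⟨e, he, hze⟩ ⟨e', he', hze'⟩ => hsepD' z ⟨e, hζA' he, hze⟩ ⟨e', hζY he', hze'⟩
  -- the two clusters agree on vertices lying on arm pairs only as `a, h₁, h₂`
  have hWW : ∀ z, (∀ e ∈ DA, z ∈ e → (z = a ∨ z = h₁ ∨ z = h₂)) → (∀ e ∈ DA', z ∈ e → (z = a ∨ z = h₁ ∨ z = h₂)) →
      (z ∈ W ↔ z ∈ W') := fun z hz hz' =>
    mem_cl_arm_replace hsep hsep' (fun _ _ _ => Or.inl rfl) (fun _ _ _ => Or.inl rfl)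
      (fun e he => hz e (hζA he)) (fun e he => hz' e (hζA' he)) hP1 hP2 hP12
  have hh1 : h₁ ∈ W ↔ h₁ ∈ W' := hWW h₁ (fun _ _ _ => Or.inr (Or.inl rfl)) (fun _ _ _ => Or.inr (Or.inl rfl))
  have hh2 : h₂ ∈ W ↔ h₂ ∈ W' := hWW h₂ (fun _ _ _ => Or.inr (Or.inr rfl)) (fun _ _ _ => Or.inr (Or.inr rfl))
  have hEY : DY \ touch W' = DY \ touch W := by
    ext e
    simp only [Finset.mem_sdiff, mem_touch, not_exists, not_and]
    constructor
    · rintro ⟨he, h1⟩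
      refine ⟨he, fun z hzW hze => h1 z ?_ hze⟩
      exact (hWW z (fun f hf hzf => Or.inr (hsepD z ⟨f, hf, hzf⟩ ⟨e, he, hze⟩))
        (fun f hf hzf => Or.inr (hsepD' z ⟨f, hf, hzf⟩ ⟨e, he, hze⟩))).1 hzW
    · rintro ⟨he, h1⟩
      refine ⟨he, fun z hzW' hze => h1 z ?_ hze⟩
      exact (hWW z (fun f hf hzf => Or.inr (hsepD z ⟨f, hf, hzf⟩ ⟨e, he, hze⟩))
        (fun f hf hzf => Or.inr (hsepD' z ⟨f, hf, hzf⟩ ⟨e, he, hze⟩))).2 hzW'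
  unfold RefinedRowR3.Sep
  rw [Finset.union_sdiff_distrib, Finset.union_sdiff_distrib, hEY]
  by_cases hhub : h₁ ∈ W ∨ h₂ ∈ W
  · -- a hub in the cluster: off the cluster both arms are networks not joining their poles
    have hJ : h₂ ∉ cl (DA \ touch W) h₁ := by
      rcases hhub with hh | hh
      · intro hJ
        have h0 : ∀ e ∈ DA \ touch W, h₁ ∉ e := fun e he h1e =>
          (Finset.mem_sdiff.1 he).2 (mem_touch.2 ⟨h₁, hh, h1e⟩)
        exact h12 (ApexTwoSum.eq_of_mem_cl_of_forall_not_mem h0 hJ).symm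
      · intro hJ
        obtain ⟨e, he, h2e⟩ := exists_mem_edge_of_mem_cl hJ h12.symm
        exact (Finset.mem_sdiff.1 he).2 (mem_touch.2 ⟨h₂, hh, h2e⟩)
    have hJ' : h₂ ∉ cl (DA' \ touch W') h₁ := by
      rcases hhub with hh | hh
      · intro hJ'
        have h0 : ∀ e ∈ DA' \ touch W', h₁ ∉ e := fun e he h1e =>
          (Finset.mem_sdiff.1 he).2 (mem_touch.2 ⟨h₁, hh1.1 hh, h1e⟩)
        exact h12 (ApexTwoSum.eq_of_mem_cl_of_forall_not_mem h0 hJ').symm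
      · intro hJ'
        obtain ⟨e, he, h2e⟩ := exists_mem_edge_of_mem_cl hJ' h12.symm
        exact (Finset.mem_sdiff.1 he).2 (mem_touch.2 ⟨h₂, hh2.1 hh, h2e⟩)
    rw [NetworkFold.mem_cl_replace (ζX := DA \ touch W) (ζX' := DA' \ touch W') (ζY := DY \ touch W) (u := h₁) (v := h₂)
      (fun z ⟨e, he, hze⟩ ⟨e', he', hze'⟩ => hsepD z ⟨e, (Finset.mem_sdiff.1 he).1, hze⟩ ⟨e', (Finset.mem_sdiff.1 he').1, hze'⟩)
      (fun z ⟨e, he, hze⟩ ⟨e', he', hze'⟩ => hsepD' z ⟨e, (Finset.mem_sdiff.1 he).1, hze⟩ ⟨e', (Finset.mem_sdiff.1 he').1, hze'⟩)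
      (fun e he hbe => hb e (Finset.mem_sdiff.1 he).1 hbe) (fun e he hbe => hb' e (Finset.mem_sdiff.1 he).1 hbe)
      (fun e he hce => hc e (Finset.mem_sdiff.1 he).1 hce) (fun e he hce => hc' e (Finset.mem_sdiff.1 he).1 hce)
      ⟨fun h => absurd h hJ, fun h => absurd h hJ'⟩]
  · -- no hub in the cluster: the rest is untouched and joins `b` to `c` on both sides
    have hh1W : h₁ ∉ W := fun h => hhub (Or.inl h)
    have hh2W : h₂ ∉ W := fun h => hhub (Or.inr h)
    have hDY : DY \ touch W = DY := touch_rest_eq_of_no_hub hsepD hζA hζY haY hh1W hh2W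
    rw [hDY]
    have lhs : c ∈ cl ((DA \ touch W) ∪ DY) b := cl_mono Finset.subset_union_right b hbc
    have rhs : c ∈ cl ((DA' \ touch W') ∪ DY) b := cl_mono Finset.subset_union_right b hbc
    exact ⟨fun h => absurd lhs h, fun h => absurd rhs h⟩

end Separation

/-! ### Event forms against the reference arm `{ah₁, ah₂, h₁h₂}` -/

section Events

variable {DA DY : Finset (Sym2 V)} {a h₁ h₂ b c : V} (h12 : h₁ ≠ h₂)
  (hsepD : ∀ z : V, (∃ e ∈ DA, z ∈ e) → (∃ e ∈ DY, z ∈ e) → (z = h₁ ∨ z = h₂)) (haY : ∀ e ∈ DY, a ∉ e)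

omit [Fintype V] in
/-- The reference arm meets anything avoiding `a` only in the hubs. [folklore] -/
theorem hsep_ref (S : Finset (Sym2 V)) (haS : ∀ e ∈ S, a ∉ e) :
    ∀ z : V, (∃ e ∈ ({s(a, h₁), s(a, h₂), s(h₁, h₂)} : Finset (Sym2 V)), z ∈ e) → (∃ e ∈ S, z ∈ e) → (z = h₁ ∨ z = h₂) := by
  rintro z ⟨e, he, hze⟩ ⟨f, hf, hzf⟩
  have hza : z ≠ a := fun h => haS f hf (h ▸ hzf)
  simp only [Finset.mem_insert, Finset.mem_singleton] at he
  rcases he with rfl | rfl | rfl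
  · rcases Sym2.mem_iff.1 hze with h | h
    · exact absurd h hza
    · exact Or.inl h
  · rcases Sym2.mem_iff.1 hze with h | h
    · exact absurd h hza
    · exact Or.inr h
  · exact Sym2.mem_iff.1 hze

omit [Fintype V] in
/-- The reference arm has no inner vertices. [folklore] -/
theorem not_inner_ref {g : Finset (Sym2 V)} (hg : g ⊆ ({s(a, h₁), s(a, h₂), s(h₁, h₂)} : Finset (Sym2 V))) (x : V) :
    ∀ e ∈ g, x ∈ e → (x = a ∨ x = h₁ ∨ x = h₂) := by
  intro e he hxe
  have he' := hg he
  simp only [Finset.mem_insert, Finset.mem_singleton] at he'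
  rcases he' with rfl | rfl | rfl
  · exact (Sym2.mem_iff.1 hxe).elim Or.inl (fun h => Or.inr (Or.inl h))
  · exact (Sym2.mem_iff.1 hxe).elim Or.inl (fun h => Or.inr (Or.inr h))
  · exact Or.inr (Sym2.mem_iff.1 hxe)

omit [Fintype V] in
/-- A vertex other than `a` lies on reference pairs only as a hub. [folklore] -/
theorem not_inner_ref' {x : V} (hax : a ≠ x) :
    ∀ e ∈ ({s(a, h₁), s(a, h₂), s(h₁, h₂)} : Finset (Sym2 V)), x ∈ e → (x = h₁ ∨ x = h₂) := fun e he hxe =>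
  (not_inner_ref (subset_refl _) x e he hxe).elim (fun h => absurd h.symm hax) id

include hsepD haY in
/-- **Event form**: for `x, y` lying on arm pairs only as `a, h₁, h₂`, `ω ⊆ DA ∪ DY`, and a reference block `g ⊆ {ah₁, ah₂, h₁h₂}` inducing the same
partition of `{a, h₁, h₂}` as `ω ∩ DA`: `y ∈ C(x)` in `ω` iff in `g ∪ (ω ∖ DA)`. [this work] -/
theorem mem_cl_iff_ref {x y : V} (hx : ∀ e ∈ DA, x ∈ e → (x = a ∨ x = h₁ ∨ x = h₂)) (hy : ∀ e ∈ DA, y ∈ e → (y = a ∨ y = h₁ ∨ y = h₂))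
    {ω g : BondConfig V} (hω : ω ⊆ ↑DA ∪ ↑DY) (hg : g ⊆ (↑({s(a, h₁), s(a, h₂), s(h₁, h₂)} : Finset (Sym2 V)) : Set (Sym2 V)))
    (hP1 : (ω ∩ ↑DA) ∈ {η : BondConfig V | h₁ ∈ cl η.toFinset a} ↔ g ∈ {η : BondConfig V | h₁ ∈ cl η.toFinset a})
    (hP2 : (ω ∩ ↑DA) ∈ {η : BondConfig V | h₂ ∈ cl η.toFinset a} ↔ g ∈ {η : BondConfig V | h₂ ∈ cl η.toFinset a})
    (hP12 : (ω ∩ ↑DA) ∈ {η : BondConfig V | h₂ ∈ cl η.toFinset h₁} ↔ g ∈ {η : BondConfig V | h₂ ∈ cl η.toFinset h₁}) :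
    y ∈ cl ω.toFinset x ↔ (g ∪ (ω \ ↑DA)) ∈ {η : BondConfig V | y ∈ cl η.toFinset x} := by
  simp only [Set.mem_setOf_eq] at hP1 hP2 hP12 ⊢
  suffices key : ∀ ζA ζY ζg ζ : Finset (Sym2 V), (∀ e, e ∈ ζA ↔ e ∈ ω ∩ (↑DA : Set (Sym2 V))) →
      (∀ e, e ∈ ζY ↔ e ∈ ω \ (↑DA : Set (Sym2 V))) → (∀ e, e ∈ ζg ↔ e ∈ g) → (∀ e, e ∈ ζ ↔ e ∈ g ∪ (ω \ (↑DA : Set (Sym2 V)))) →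
      (h₁ ∈ cl ζA a ↔ h₁ ∈ cl ζg a) → (h₂ ∈ cl ζA a ↔ h₂ ∈ cl ζg a) → (h₂ ∈ cl ζA h₁ ↔ h₂ ∈ cl ζg h₁) →
      (y ∈ cl ω.toFinset x ↔ y ∈ cl ζ x) by
    refine key _ (ω \ (↑DA : Set (Sym2 V))).toFinset _ _ ?_ (fun e => by simp only [Set.mem_toFinset]) ?_ ?_ hP1 hP2 hP12
    · intro e; simp only [Set.mem_toFinset]
    · intro e; simp only [Set.mem_toFinset]
    · intro e; simp only [Set.mem_toFinset]
  intro ζA ζY ζg ζ hA hY hζg hζ hq1 hq2 hq12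
  obtain ⟨hωζ, hAD, hYD, hsep⟩ := ApexTwoSum.blocks_of_eq hsepD hω hA hY
  have hζ' : ζ = ζg ∪ ζY := by
    ext e; rw [hζ, Finset.mem_union, hζg, hY, Set.mem_union]
  have hgD : ζg ⊆ ({s(a, h₁), s(a, h₂), s(h₁, h₂)} : Finset (Sym2 V)) := fun e he =>
    Finset.mem_coe.1 (hg ((hζg e).1 he))
  rw [hωζ, hζ']
  exact mem_cl_arm_replace hsep (fun z hz hzY => hsep_ref ζY (fun e he => haY e (hYD he)) z (hz.imp fun e he => ⟨hgD he.1, he.2⟩) hzY)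
    (fun e he => hx e (hAD he)) (not_inner_ref hgD x) (fun e he => hy e (hAD he)) (not_inner_ref hgD y) hq1 hq2 hq12

include h12 hsepD haY in
/-- **Event form of the separation rule** (given `c ∈ cl DY b`). [this work] -/
theorem sep_iff_ref (hab : a ≠ b) (hac : a ≠ c) (hb : ∀ e ∈ DA, b ∈ e → (b = h₁ ∨ b = h₂)) (hc : ∀ e ∈ DA, c ∈ e → (c = h₁ ∨ c = h₂)) (hbc : c ∈ cl DY b)
    {ω g : BondConfig V} (hω : ω ⊆ ↑DA ∪ ↑DY) (hg : g ⊆ (↑({s(a, h₁), s(a, h₂), s(h₁, h₂)} : Finset (Sym2 V)) : Set (Sym2 V)))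
    (hP1 : (ω ∩ ↑DA) ∈ {η : BondConfig V | h₁ ∈ cl η.toFinset a} ↔ g ∈ {η : BondConfig V | h₁ ∈ cl η.toFinset a})
    (hP2 : (ω ∩ ↑DA) ∈ {η : BondConfig V | h₂ ∈ cl η.toFinset a} ↔ g ∈ {η : BondConfig V | h₂ ∈ cl η.toFinset a})
    (hP12 : (ω ∩ ↑DA) ∈ {η : BondConfig V | h₂ ∈ cl η.toFinset h₁} ↔ g ∈ {η : BondConfig V | h₂ ∈ cl η.toFinset h₁}) :
    Sep (DA ∪ DY) (cl ω.toFinset a) b c ↔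
      (g ∪ (ω \ ↑DA)) ∈ {η : BondConfig V | Sep ({s(a, h₁), s(a, h₂), s(h₁, h₂)} ∪ DY) (cl η.toFinset a) b c} := by
  simp only [Set.mem_setOf_eq] at hP1 hP2 hP12 ⊢
  suffices key : ∀ ζA ζY ζg ζ : Finset (Sym2 V), (∀ e, e ∈ ζA ↔ e ∈ ω ∩ (↑DA : Set (Sym2 V))) →
      (∀ e, e ∈ ζY ↔ e ∈ ω \ (↑DA : Set (Sym2 V))) → (∀ e, e ∈ ζg ↔ e ∈ g) → (∀ e, e ∈ ζ ↔ e ∈ g ∪ (ω \ (↑DA : Set (Sym2 V)))) →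
      (h₁ ∈ cl ζA a ↔ h₁ ∈ cl ζg a) → (h₂ ∈ cl ζA a ↔ h₂ ∈ cl ζg a) → (h₂ ∈ cl ζA h₁ ↔ h₂ ∈ cl ζg h₁) →
      (Sep (DA ∪ DY) (cl ω.toFinset a) b c ↔ Sep ({s(a, h₁), s(a, h₂), s(h₁, h₂)} ∪ DY) (cl ζ a) b c) by
    refine key _ (ω \ (↑DA : Set (Sym2 V))).toFinset _ _ ?_ (fun e => by simp only [Set.mem_toFinset]) ?_ ?_ hP1 hP2 hP12
    · intro e; simp only [Set.mem_toFinset]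
    · intro e; simp only [Set.mem_toFinset]
    · intro e; simp only [Set.mem_toFinset]
  intro ζA ζY ζg ζ hA hY hζg hζ hq1 hq2 hq12
  obtain ⟨hωζ, hAD, hYD, hsep⟩ := ApexTwoSum.blocks_of_eq hsepD hω hA hY
  have hζ' : ζ = ζg ∪ ζY := by
    ext e; rw [hζ, Finset.mem_union, hζg, hY, Set.mem_union]
  have hgD : ζg ⊆ ({s(a, h₁), s(a, h₂), s(h₁, h₂)} : Finset (Sym2 V)) := fun e he =>
    Finset.mem_coe.1 (hg ((hζg e).1 he))
  rw [hωζ, hζ']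
  exact sep_arm_replace h12 hsepD (hsep_ref DY haY) hAD hgD hYD haY hb (not_inner_ref' hab) hc (not_inner_ref' hac) hbc hq1 hq2 hq12

end Events

end HubPairApex

end Summit.CriticalPhenomena.PercolationContinuityZ3.Theorems
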